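import Summits.AtomisticToContinuum.HydrodynamicLimit.Theorems.AntiMazurCoboundariesKineticFluxLdDecayHTheoremObjectsB
import Summits.AtomisticToContinuum.HydrodynamicLimit.Theorems.KineticFluxLdDecay.Negative.TiltLowerBound
import HarnessLib

/-!
# The macrostate-mixture witness against the `∀ν` H-theorem budgets — statics
# (crux `KineticFluxLdDecay`, stmt-AtomisticToContinuum-10967; line `h-theorem-dissipation-budget`, lead a2)

The line's bets `NoPerpetualDissipation` / `NoPerpetualDissipationBdd`
(`Theorems/AntiMazurCoboundariesKineticFluxLdDecayHTheoremObjects{,B}.lean`) assert an entropy budget for the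
time-integrated Hellinger production of the reduced one-body law of EVERY finite-entropy initial law `ν ≪ G_N`.
They are false by the MACROSTATE-MIXTURE artefact: the even mixture `ν = ½(G_N^{θ=1} + G_N^{θ=2})` of two
homogeneous Gibbs laws at different temperatures is flow-invariant, has entropy `KL(ν ‖ G_N) ≤ (N+1)·S₀`, and its
reduced one-body law is `π̄_N ⊗ ½(N(0, I) + N(0, 2I))` — a product law whose velocity factor is a NON-Maxwellian
Gaussian mixture, so that Boltzmann's production functional reports a constant positive dissipation for all
times although no realisation ever dissipates. This file supplies the STATIC facts about the witness
(frame `a = 1`, `u₀ = 0`, `θ = 1`):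

* `mixtureLaw σ N Φ = ½ G_N^{(1)} + ½ G_N^{(2)}`: a probability law (`σ ≤ 1/2`), `≪ G_N^{(1)}` with the explicit
  density `½ + ½ e^{-L}`, `L = Σᵢ llr1 2 0 vᵢ` (the tree's Gibbs tilt identity
  `KineticFluxLdDecayTilt.localGibbsMeasure_ref_eq_withDensity`), invariant under every hard-sphere flow
  (`Theorems.measurePreserving_flow_localGibbsLaw_const`);
* `KL(mixtureLaw ‖ G_N) ≤ (N+1)·S₀` for an absolute constant `S₀` (`|log(½ + ½e^{-L})| ≤ |L| + 1` and the
  Gaussian one-site means of `|llr1|`, `KineticFluxLdDecayTilt.integral_sum_vel_localGibbsMeasure_const`);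
* the reduced one-body law of the witness at every time is the product law `posLaw σ N ⊗ γ·velMixDensity`
  (`posLaw` = the particle-averaged one-particle marginal of the configurational Gibbs measure,
  `velMixDensity w = ½ + ½ e^{-llr1 2 0 w}` the density of `½(N(0,I) + N(0,2I))` w.r.t. `γ`), by the
  disintegration `lintegral_localGibbsMeasure` of the tree and uniqueness of product measures on rectangles.

Reference for the physics: the deterministic dynamics conserves energy, hence has a continuum of invariant
Gibbs laws and their statistical mixtures (Spohn 1991, Part I §2.3); the ensemble one-body law of a mixture is a
mixture of Maxwellians.
-/

noncomputable section

open MeasureTheory ProbabilityTheory Set Filter InformationTheory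
open scoped ENNReal NNReal

namespace Summit.AtomisticToContinuum.HydrodynamicLimit.Theorems.HTheorem

open Literature.MathematicalPhysics.KineticTheory (T3 V3 hsDiameter localGibbsLaw localGibbsMeasure localGibbsLaw_eq
  gaussMeasure posGibbsMeasure)
open Literature.Analysis.FluidPDE (HardSphereFlow Config)
open Summit.AtomisticToContinuum.HydrodynamicLimit.Theorems.KineticFluxLdDecayTilt (llr1 llrConfig)

namespace MixtureWitness

/-! ## The frame at `a = 1`, `u₀ = 0`, `θ = 1` -/

/-- At reference temperature `θ = 1` and drift `u₀ = 0` the reduced coordinates of particle `i` are its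
coordinates. -/
theorem reducedCoord_one_zero (n : ℕ) (i : Fin n) : reducedCoord 1 0 n i = fun z => z i := by
  funext z
  simp [reducedCoord, Real.sqrt_one]

/-- The homogeneous Gibbs law of the crux at activity `1`, drift `0` and temperature `θ₁` is the flow-free
Gibbs measure. -/
theorem gibbs_eq (σ θ₁ : ℝ) (N : ℕ) (Φ : Flow σ N) :
    gibbs σ 1 θ₁ 0 N Φ = localGibbsMeasure σ (fun _ => 1) (fun _ => 0) (fun _ => θ₁) N :=
  localGibbsLaw_eq σ _ _ _ N Φ

/-- The Gibbs laws at `σ ≤ 1/2` are probability laws (every temperature `θ₁ > 0`). -/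
theorem isProbabilityMeasure_gibbs {σ θ₁ : ℝ} (hθ₁ : 0 < θ₁) (hσ2 : σ ≤ 1 / 2) (N : ℕ) (Φ : Flow σ N) :
    IsProbabilityMeasure (gibbs σ 1 θ₁ 0 N Φ) :=
  Literature.MathematicalPhysics.KineticTheory.isProbabilityMeasure_localGibbsLaw continuous_const
    continuous_const continuous_const (fun _ => one_pos) (fun _ => hθ₁) hσ2 N Φ

/-! ## The two-temperature tilt -/

/-- The density `e^{-L}`, `L = Σᵢ llr1 2 0 vᵢ`, of the temperature-`2` Gibbs law w.r.t. the temperature-`1` one. -/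
def hotDensity (N : ℕ) (z : Phase N) : ℝ≥0∞ :=
  ENNReal.ofReal (Real.exp (-llrConfig 2 0 z))

/-- `hotDensity` is measurable. -/
theorem measurable_hotDensity (N : ℕ) : Measurable (hotDensity N) :=
  (Summit.AtomisticToContinuum.HydrodynamicLimit.Theorems.KineticFluxLdDecayTilt.measurable_llrConfig
    two_pos 0 (N + 1)).neg.exp.ennreal_ofReal

/-- **Two-temperature tilt identity**: `G_N^{(2)} = e^{-L} · G_N^{(1)}` (inverse form of the tree's
`localGibbsMeasure_ref_eq_withDensity`: `G^{(1)} = e^{L} · G^{(2)}` and `e^{L} e^{-L} = 1`). -/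
theorem gibbs_two_eq_withDensity (σ : ℝ) (N : ℕ) (Φ : Flow σ N) :
    gibbs σ 1 2 0 N Φ = (gibbs σ 1 1 0 N Φ).withDensity (hotDensity N) := by
  rw [gibbs_eq, gibbs_eq,
    Summit.AtomisticToContinuum.HydrodynamicLimit.Theorems.KineticFluxLdDecayTilt.localGibbsMeasure_ref_eq_withDensity
      σ two_pos 0 N]
  have hmL : Measurable fun z : Phase N => ENNReal.ofReal (Real.exp (llrConfig 2 0 z)) :=
    (Summit.AtomisticToContinuum.HydrodynamicLimit.Theorems.KineticFluxLdDecayTilt.measurable_llrConfig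
      two_pos 0 (N + 1)).exp.ennreal_ofReal
  rw [← withDensity_mul _ hmL (measurable_hotDensity N)]
  have h1 : ((fun z : Phase N => ENNReal.ofReal (Real.exp (llrConfig 2 0 z))) * hotDensity N) = 1 := by
    funext z
    simp only [Pi.mul_apply, hotDensity, Pi.one_apply]
    rw [← ENNReal.ofReal_mul (Real.exp_pos _).le, ← Real.exp_add, add_neg_cancel, Real.exp_zero,
      ENNReal.ofReal_one]
  rw [h1, withDensity_one]

/-! ## The mixture law -/

/-- THE WITNESS: the even mixture `ν = ½ G_N^{(1)} + ½ G_N^{(2)}` of the homogeneous Gibbs laws at temperatures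
`1` and `2` (activity `1`, drift `0`). -/
def mixtureLaw (σ : ℝ) (N : ℕ) (Φ : Flow σ N) : Measure (Phase N) :=
  (2⁻¹ : ℝ≥0∞) • gibbs σ 1 1 0 N Φ + (2⁻¹ : ℝ≥0∞) • gibbs σ 1 2 0 N Φ

/-- The density `½ + ½ e^{-L}` of the mixture w.r.t. `G_N^{(1)}`. -/
def mixDensity (N : ℕ) (z : Phase N) : ℝ≥0∞ :=
  2⁻¹ + 2⁻¹ * hotDensity N z

/-- `mixDensity` is measurable. -/
theorem measurable_mixDensity (N : ℕ) : Measurable (mixDensity N) :=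
  measurable_const.add (measurable_const.mul (measurable_hotDensity N))

/-- The mixture is `G_N^{(1)}` with density `½ + ½ e^{-L}`. -/
theorem mixtureLaw_eq_withDensity (σ : ℝ) (N : ℕ) (Φ : Flow σ N) :
    mixtureLaw σ N Φ = (gibbs σ 1 1 0 N Φ).withDensity (mixDensity N) := by
  have h : mixDensity N = (fun _ => (2⁻¹ : ℝ≥0∞)) + (2⁻¹ : ℝ≥0∞) • hotDensity N := by
    funext z; simp [mixDensity]
  rw [h, withDensity_add_left measurable_const, withDensity_const, withDensity_smul _ (measurable_hotDensity N),
    ← gibbs_two_eq_withDensity, mixtureLaw]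

/-- The mixture is absolutely continuous w.r.t. `G_N^{(1)}`. -/
theorem mixtureLaw_absolutelyContinuous (σ : ℝ) (N : ℕ) (Φ : Flow σ N) :
    mixtureLaw σ N Φ ≪ gibbs σ 1 1 0 N Φ := by
  rw [mixtureLaw_eq_withDensity]
  exact withDensity_absolutelyContinuous _ _

/-- The mixture is a probability law (`σ ≤ 1/2`). -/
theorem isProbabilityMeasure_mixtureLaw {σ : ℝ} (hσ2 : σ ≤ 1 / 2) (N : ℕ) (Φ : Flow σ N) :
    IsProbabilityMeasure (mixtureLaw σ N Φ) := by
  haveI := isProbabilityMeasure_gibbs one_pos hσ2 N Φ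
  haveI := isProbabilityMeasure_gibbs two_pos hσ2 N Φ
  refine ⟨?_⟩
  simp only [mixtureLaw, Measure.add_apply, Measure.smul_apply, measure_univ, smul_eq_mul, mul_one]
  exact ENNReal.inv_two_add_inv_two

/-- **The mixture is flow-invariant** (each Gibbs component is, `Theorems.measurePreserving_flow_localGibbsLaw_const`). -/
theorem map_flow_mixtureLaw (σ : ℝ) (N : ℕ) (Φ : Flow σ N) (t : ℝ) :
    (mixtureLaw σ N Φ).map (Φ.flow t) = mixtureLaw σ N Φ := by
  have h1 := (Summit.AtomisticToContinuum.HydrodynamicLimit.Theorems.measurePreserving_flow_localGibbsLaw_const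
    σ 1 1 0 N Φ t).map_eq
  have h2 := (Summit.AtomisticToContinuum.HydrodynamicLimit.Theorems.measurePreserving_flow_localGibbsLaw_const
    σ 1 2 0 N Φ t).map_eq
  simp only [mixtureLaw, Measure.map_add _ _ (Φ.measurable_flow t), Measure.map_smul]
  simp only [gibbs] at *
  rw [h1, h2]

/-- The mixture law transported along the flow is itself: `MeasurePreserving` form. -/
theorem measurePreserving_flow_mixtureLaw (σ : ℝ) (N : ℕ) (Φ : Flow σ N) (t : ℝ) :
    MeasurePreserving (Φ.flow t) (mixtureLaw σ N Φ) (mixtureLaw σ N Φ) :=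
  ⟨Φ.measurable_flow t, map_flow_mixtureLaw σ N Φ t⟩


/-! ## The entropy of the mixture: `KL(ν ‖ G_N) ≤ (N+1)·S₀` -/

/-- Elementary: `|log(½ + ½ e^{-L})| ≤ |L| + 1`. -/
theorem abs_log_mix_le (L : ℝ) : |Real.log (2⁻¹ + 2⁻¹ * Real.exp (-L))| ≤ |L| + 1 := by
  set u := Real.exp (-L) with hu
  have hu0 : 0 < u := Real.exp_pos _
  have hpos : 0 < 2⁻¹ + 2⁻¹ * u := by positivity
  have hlog2 : Real.log 2 ≤ 1 := by
    have := Real.log_le_sub_one_of_pos (x := 2) two_pos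
    linarith
  refine abs_le.2 ⟨?_, ?_⟩
  · -- lower bound: `½ + ½u ≥ ½`
    have h1 : Real.log 2⁻¹ ≤ Real.log (2⁻¹ + 2⁻¹ * u) :=
      Real.log_le_log (by norm_num) (by nlinarith)
    rw [Real.log_inv] at h1
    have : 0 ≤ |L| := abs_nonneg L
    linarith
  · -- upper bound: `½ + ½u ≤ max 1 u`
    have h2 : Real.log (2⁻¹ + 2⁻¹ * u) ≤ Real.log (max 1 u) :=
      Real.log_le_log hpos (by
        rcases le_total u 1 with h | h
        · calc 2⁻¹ + 2⁻¹ * u ≤ 2⁻¹ + 2⁻¹ * 1 := by gcongr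
            _ = 1 := by norm_num
            _ ≤ max 1 u := le_max_left _ _
        · calc 2⁻¹ + 2⁻¹ * u ≤ 2⁻¹ * u + 2⁻¹ * u := by nlinarith
            _ = u := by ring
            _ ≤ max 1 u := le_max_right _ _)
    have h3 : Real.log (max 1 u) ≤ |L| := by
      rcases le_total u 1 with h | h
      · rw [max_eq_left h, Real.log_one]; exact abs_nonneg L
      · rw [max_eq_right h, hu, Real.log_exp]; exact neg_le_abs L
    linarith

/-- Integrability of `llr1 θ₁ u₁` under ANY isotropic Gaussian (it is a quadratic polynomial). -/
theorem integrable_llr1_gaussMeasure {θ₁ : ℝ} (hθ₁ : 0 < θ₁) (u₁ u : V3) (θ : ℝ) :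
    Integrable (llr1 θ₁ u₁) (gaussMeasure u θ) := by
  have h2 : Integrable (fun v : V3 => ‖v‖ ^ 2) (gaussMeasure u θ) :=
    (IsGaussian.memLp_id _ 2 (by simp)).integrable_norm_pow (by norm_num)
  have h3 : Integrable (fun v : V3 => ‖v - u₁‖ ^ 2) (gaussMeasure u θ) :=
    ((IsGaussian.memLp_id (gaussMeasure u θ) 2 (by simp)).sub (memLp_const u₁)).integrable_norm_pow
      (by norm_num)
  have : llr1 θ₁ u₁ = fun v => 3 / 2 * Real.log θ₁ - ‖v‖ ^ 2 / 2 + ‖v - u₁‖ ^ 2 / (2 * θ₁) :=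
    funext fun v => Summit.AtomisticToContinuum.HydrodynamicLimit.Theorems.KineticFluxLdDecayTilt.llr1_eq hθ₁ u₁ v
  rw [this]
  exact ((integrable_const _).sub (h2.div_const 2)).add (h3.div_const _)

/-- The dominating function `Σᵢ |llr1 2 0 vᵢ| + 1` is integrable under each Gibbs component, with mean
`(N+1) ∫ |llr1 2 0| dN(0, θ₁) + 1`. -/
theorem integral_dominator_gibbs {σ θ₁ : ℝ} (hθ₁ : 0 < θ₁) (hσ2 : σ ≤ 1 / 2) (N : ℕ) (Φ : Flow σ N) :
    Integrable (fun z : Phase N => ∑ i, |llr1 2 0 (z i).2| + 1) (gibbs σ 1 θ₁ 0 N Φ) ∧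
      ∫ z, (∑ i, |llr1 2 0 (z i).2| + 1) ∂gibbs σ 1 θ₁ 0 N Φ =
        ((N + 1 : ℕ) : ℝ) * ∫ v, |llr1 2 0 v| ∂gaussMeasure 0 θ₁ + 1 := by
  haveI := isProbabilityMeasure_gibbs hθ₁ hσ2 N Φ
  have hf : Integrable (fun v : V3 => |llr1 2 0 v|) (gaussMeasure 0 θ₁) :=
    (integrable_llr1_gaussMeasure two_pos 0 0 θ₁).abs
  have hsum : Integrable (fun z : Phase N => ∑ i, |llr1 2 0 (z i).2|) (gibbs σ 1 θ₁ 0 N Φ) := by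
    rw [gibbs_eq]
    exact Summit.AtomisticToContinuum.HydrodynamicLimit.Theorems.KineticFluxLdDecayTilt.integrable_sum_vel_localGibbsMeasure_const
      σ 1 θ₁ 0 one_pos hθ₁ hσ2 N (f := fun v => |llr1 2 0 v|) hf
  refine ⟨hsum.add (integrable_const _), ?_⟩
  rw [integral_add hsum (integrable_const _), integral_const, probReal_univ, one_smul]
  congr 1
  rw [gibbs_eq]
  exact Summit.AtomisticToContinuum.HydrodynamicLimit.Theorems.KineticFluxLdDecayTilt.integral_sum_vel_localGibbsMeasure_const
    σ 1 θ₁ 0 one_pos hθ₁ hσ2 N (f := fun v => |llr1 2 0 v|) hf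

/-- The absolute entropy constant of the witness:
`S₀ = ∫ |llr1 2 0| dN(0, I) + ∫ |llr1 2 0| dN(0, 2I) + 1`. -/
def klConst : ℝ :=
  ∫ v, |llr1 2 0 v| ∂gaussMeasure (0 : V3) 1 + ∫ v, |llr1 2 0 v| ∂gaussMeasure (0 : V3) 2 + 1

/-- `0 ≤ S₀` (indeed `1 ≤ S₀`). -/
theorem klConst_nonneg : 0 ≤ klConst := by
  have h1 : 0 ≤ ∫ v, |llr1 2 0 v| ∂gaussMeasure (0 : V3) 1 := integral_nonneg fun _ => abs_nonneg _
  have h2 : 0 ≤ ∫ v, |llr1 2 0 v| ∂gaussMeasure (0 : V3) 2 := integral_nonneg fun _ => abs_nonneg _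
  unfold klConst; linarith

/-- The log-likelihood ratio of the mixture against `G_N^{(1)}` is `log(½ + ½e^{-L})` almost surely. -/
theorem llr_mixtureLaw_ae_eq {σ : ℝ} (hσ2 : σ ≤ 1 / 2) (N : ℕ) (Φ : Flow σ N) :
    llr (mixtureLaw σ N Φ) (gibbs σ 1 1 0 N Φ) =ᵐ[mixtureLaw σ N Φ]
      fun z => Real.log (2⁻¹ + 2⁻¹ * Real.exp (-llrConfig 2 0 z)) := by
  haveI := isProbabilityMeasure_gibbs one_pos hσ2 N Φ
  have hrn : (mixtureLaw σ N Φ).rnDeriv (gibbs σ 1 1 0 N Φ) =ᵐ[gibbs σ 1 1 0 N Φ] mixDensity N := by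
    rw [mixtureLaw_eq_withDensity]
    exact Measure.rnDeriv_withDensity _ (measurable_mixDensity N)
  filter_upwards [(mixtureLaw_absolutelyContinuous σ N Φ).ae_le hrn] with z hz
  simp only [llr, hz]
  congr 1
  simp only [mixDensity, hotDensity]
  rw [ENNReal.toReal_add (by simp) (ENNReal.mul_ne_top (by simp) ENNReal.ofReal_ne_top), ENNReal.toReal_mul,
    ENNReal.toReal_ofReal (Real.exp_pos _).le, ENNReal.toReal_inv]
  norm_num

/-- **Entropy of the witness**: `KL(ν ‖ G_N^{(1)}) < ∞` and `KL(ν ‖ G_N^{(1)}) ≤ (N+1)·S₀` with the absolute constant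
`S₀ = klConst`, for every `σ ≤ 1/2`, every `N` and every flow. -/
theorem klDiv_mixtureLaw_le {σ : ℝ} (hσ2 : σ ≤ 1 / 2) (N : ℕ) (Φ : Flow σ N) :
    klDiv (mixtureLaw σ N Φ) (gibbs σ 1 1 0 N Φ) ≠ ⊤ ∧
      (klDiv (mixtureLaw σ N Φ) (gibbs σ 1 1 0 N Φ)).toReal ≤ ((N + 1 : ℕ) : ℝ) * klConst := by
  haveI := isProbabilityMeasure_gibbs one_pos hσ2 N Φ
  haveI := isProbabilityMeasure_gibbs two_pos hσ2 N Φ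
  haveI := isProbabilityMeasure_mixtureLaw hσ2 N Φ
  set ν := mixtureLaw σ N Φ with hν
  set G := gibbs σ 1 1 0 N Φ with hG
  have hac : ν ≪ G := mixtureLaw_absolutelyContinuous σ N Φ
  -- the dominating function and its integrability / mean under `ν`
  set g : Phase N → ℝ := fun z => ∑ i, |llr1 2 0 (z i).2| + 1 with hg
  obtain ⟨hg1, hI1⟩ := integral_dominator_gibbs one_pos hσ2 N Φ
  obtain ⟨hg2, hI2⟩ := integral_dominator_gibbs two_pos hσ2 N Φ
  have hgν : Integrable g ν := by
    rw [hν, mixtureLaw]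
    exact (hg1.smul_measure (by simp)).add_measure (hg2.smul_measure (by simp))
  have hbound : ∀ᵐ z ∂ν, ‖llr ν G z‖ ≤ g z := by
    filter_upwards [llr_mixtureLaw_ae_eq hσ2 N Φ] with z hz
    rw [hz, Real.norm_eq_abs]
    refine (abs_log_mix_le _).trans ?_
    simp only [hg, llrConfig]
    gcongr
    exact Finset.abs_sum_le_sum_abs _ _
  have hint : Integrable (llr ν G) ν :=
    hgν.mono' (Measure.measurable_rnDeriv ν G).ennreal_toReal.log.aestronglyMeasurable hbound
  refine ⟨klDiv_ne_top hac hint, ?_⟩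
  rw [toReal_klDiv_of_measure_eq hac (by simp [measure_univ])]
  have hle : ∫ z, llr ν G z ∂ν ≤ ∫ z, g z ∂ν :=
    integral_mono_ae hint hgν (hbound.mono fun z hz => (le_abs_self _).trans (Real.norm_eq_abs _ ▸ hz))
  refine hle.trans ?_
  -- evaluate `∫ g dν`
  have hsplit : ∫ z, g z ∂ν = 2⁻¹ * ∫ z, g z ∂gibbs σ 1 1 0 N Φ + 2⁻¹ * ∫ z, g z ∂gibbs σ 1 2 0 N Φ := by
    have hg1' : Integrable g ((2⁻¹ : ℝ≥0∞) • gibbs σ 1 1 0 N Φ) := hg1.smul_measure (by simp)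
    have hg2' : Integrable g ((2⁻¹ : ℝ≥0∞) • gibbs σ 1 2 0 N Φ) := hg2.smul_measure (by simp)
    rw [hν, mixtureLaw, integral_add_measure hg1' hg2', integral_smul_measure, integral_smul_measure]
    simp only [smul_eq_mul, ENNReal.toReal_inv, ENNReal.toReal_ofNat]
  rw [hsplit, hI1, hI2]
  have hN : (1 : ℝ) ≤ ((N + 1 : ℕ) : ℝ) := by exact_mod_cast Nat.succ_le_succ (Nat.zero_le N)
  have h1 : 0 ≤ ∫ v, |llr1 2 0 v| ∂gaussMeasure (0 : V3) 1 := integral_nonneg fun _ => abs_nonneg _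
  have h2 : 0 ≤ ∫ v, |llr1 2 0 v| ∂gaussMeasure (0 : V3) 2 := integral_nonneg fun _ => abs_nonneg _
  unfold klConst
  nlinarith

end MixtureWitness

end Summit.AtomisticToContinuum.HydrodynamicLimit.Theorems.HTheorem

end
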